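import Summits.HodgeConjecture.CorCM.Census.QuarticInversionOrbit

/-!
# The quartic inversion twists, XVIII: the normal forms of the translated equator squares (the generators of the closing lattice)

COR-CM (cell `pub-hodgecm2`, stage 2 of the Hodge ladder), count-neutral KERNEL COMBINATORICS by the binder seat b23 (gen 44; claim
QUARTIC-INVERSION, HOME/INBOX.md l.12829).  Part XVIII of the lane `Census/QuarticInversion*`, on top of parts I–XVI, all BY NAME.
Bookkeeping definitions with bodies (`cB`, `ΦL`, the sign vectors `kS`, `kY`, `kT`, `kTY`) + theorems; no `Prop`-valued definition, no
`decide` beyond closed identities in `Bool`/`Fin 4`, no certificate, no named fact, no geometry, no `sorry`.  `Interfaces.lean` (C1), every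
E term, B01, `Transposition/*`, `PortJoin/*` untouched.
HONEST FRAMING: `HC_CM` is NOT proved, here or anywhere in the tree; nothing here is a period, a count of record or a headline.

CONTENT (`|B|` odd `≥ 3`).
* §1 `ΦL`, the coordinate embedding of part XV as a linear map of `V = (Fin 4 → ℤ) × (patterns → ℤ)`; the normal form lies in the value
  module whenever all binomials do (`nf_mem_of_bin`).
* §2 **Columns of translates**: `kOf j (y·v) = ± kOf (σY j) v`, `kOf j (t·v) = ± kOf (σT j) v` (signs on the masks); hence the normal form
  of a translate (`nf_translY`, `nf_translT`).
* §3 **The equator square**: `kOf j (S_b) = [j = 0]` and `C_η(S_b) = cB b η` (part X), so `nf (S_b) = ΦL (kS, cB b)`; with §2 the normal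
  forms of `y·S_b`, `t·S_b`, `t·y·S_b` are `ΦL` of explicit pairs (`nf_S`, `nf_yS`, `nf_tS`, `nf_tyS`) — the twelve generators of the
  closing lattice that part XIX checks against the relations.  All [folklore].

## References
* [Pohlmann1968] H. Pohlmann, Algebraic cycles on abelian varieties of complex multiplication type, Ann. of Math. 88 (1968), Thm 1.
-/

namespace Summit.HodgeConjecture.CorCM.Census.QuarticInversion

open Finset
open Summit.HodgeConjecture.CorCM.Census.OddSliceFacesModel

noncomputable section

variable (A : Type) [AddCommGroup A] [Fintype A] [DecidableEq A]

/-! ## §1 The coordinate embedding as a linear map -/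

/-- **`ΦL (k, C) = Φ k C`** as a `ℤ`-linear map. [folklore] -/
def ΦL : ((Fin 4 → ℤ) × ((Fin 4 → Bool) → ℤ)) →ₗ[ℤ] (Idx A → ℤ) where
  toFun p := Φ A p.1 p.2
  map_add' p q := by rw [Prod.fst_add, Prod.snd_add, Φ_add]
  map_smul' c p := by rw [Prod.smul_fst, Prod.smul_snd, Φ_smul, RingHom.id_apply]

omit [AddCommGroup A] [Fintype A] [DecidableEq A] in
/-- `ΦL (k, C) = Φ k C`. [folklore] -/
@[simp] theorem ΦL_apply (k : Fin 4 → ℤ) (C : (Fin 4 → Bool) → ℤ) : ΦL A (k, C) = Φ A k C := rfl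

/-- `nf v = ΦL (kOf · v, C_· v)`. [folklore] -/
theorem nf_eq_ΦL (v : Ty₄ A → ℤ) : nf A v = ΦL A (fun j => kOf A j v, fun η => fnl A (wC A η) v) := rfl

/-- **The normal form of a member of the orbit span lies in the value module** once every slot binomial does. [folklore] -/
theorem nf_mem_of_bin (hA : Odd (Fintype.card A)) (ζ : ZMod 2) {F : Set (Ty₄ A → ℤ)} (hF : F ⊆ hodge₄ A)
    (hbin : ∀ j h h' u, binVec A j h h' u ∈ valMod A ζ F) {v : Ty₄ A → ℤ} (hv : v ∈ orbSpan A ζ F) :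
    nf A v ∈ valMod A ζ F := by
  have hle : binSpan A ≤ valMod A ζ F := Submodule.span_le.mpr (by rintro _ ⟨j, h, h', u, rfl⟩; exact hbin j h h' u)
  have h1 := Avec_mem_valMod A ζ F hv
  have h2 := hle (Avec_sub_nf_mem A hA (orbSpan_le_hodge₄ A ζ hF hv))
  have := (valMod A ζ F).sub_mem h1 h2
  rwa [sub_sub_cancel] at this

/-! ## §2 Columns of translates -/

/-- **`fnl (wUp j s) (y·v) = ± fnl (wUp (σY j) (−s)) v`.** [folklore] -/
theorem fnl_wUp_translY (hA : Odd (Fintype.card A)) (ζ : ZMod 2) (j : Fin 4) (s : A) (v : Ty₄ A → ℤ) :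
    fnl A (wUp A j s) (translY A ζ v) = (if bY ζ j then -1 else 1) * fnl A (wUp A (σY j) (-s)) v := by
  rw [fnl_translY]
  cases hb : bY ζ j
  · have hw : (wUp A j s ∘ twY A ζ) = wUp A (σY j) (-s) := by funext Θ; simp only [Function.comp, wUp_twY A hA, hb]; rfl
    rw [hw]; simp
  · have hw : (wUp A j s ∘ twY A ζ) = (wUp A (σY j) (-s) ∘ conj₄ A) := by
      funext Θ; simp only [Function.comp, wUp_twY A hA, hb, if_true]
    rw [hw, fnl_comp_conj₄]; simp

/-- **`fnl (wUp j s) (t·v) = ± fnl (wUp (σT j) s) v`.** [folklore] -/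
theorem fnl_wUp_translT (hA : Odd (Fintype.card A)) (j : Fin 4) (s : A) (v : Ty₄ A → ℤ) :
    fnl A (wUp A j s) (translT A v) = (if bT j then -1 else 1) * fnl A (wUp A (σT j) s) v := by
  rw [fnl_translT]
  cases hb : bT j
  · have hw : (wUp A j s ∘ twT A) = wUp A (σT j) s := by funext Θ; simp only [Function.comp, wUp_twT A hA, hb]; rfl
    rw [hw]; simp
  · have hw : (wUp A j s ∘ twT A) = (wUp A (σT j) s ∘ conj₄ A) := by
      funext Θ; simp only [Function.comp, wUp_twT A hA, hb, if_true]
    rw [hw, fnl_comp_conj₄]; simp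

/-- `kOf j (y·v) = ± kOf (σY j) v`. [folklore] -/
theorem kOf_translY (hA : Odd (Fintype.card A)) (ζ : ZMod 2) (j : Fin 4) (v : Ty₄ A → ℤ) :
    kOf A j (translY A ζ v) = (if bY ζ j then -1 else 1) * kOf A (σY j) v := by
  unfold kOf; rw [fnl_wUp_translY A hA, neg_zero]

/-- `kOf j (t·v) = ± kOf (σT j) v`. [folklore] -/
theorem kOf_translT (hA : Odd (Fintype.card A)) (j : Fin 4) (v : Ty₄ A → ℤ) :
    kOf A j (translT A v) = (if bT j then -1 else 1) * kOf A (σT j) v := by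
  unfold kOf; rw [fnl_wUp_translT A hA]

/-- **The normal form of `y·v`.** [folklore] -/
theorem nf_translY (hA : Odd (Fintype.card A)) (ζ : ZMod 2) (v : Ty₄ A → ℤ) :
    nf A (translY A ζ v) =
      ΦL A (fun j => (if bY ζ j then -1 else 1) * kOf A (σY j) v, fun η => fnl A (wC A (pY ζ η)) v) := by
  rw [nf_eq_ΦL]
  congr 1
  ext j
  · exact kOf_translY A hA ζ j v
  · exact fnl_wC_translY A hA ζ _ v

/-- **The normal form of `t·v`.** [folklore] -/
theorem nf_translT (hA : Odd (Fintype.card A)) (v : Ty₄ A → ℤ) :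
    nf A (translT A v) = ΦL A (fun j => (if bT j then -1 else 1) * kOf A (σT j) v, fun η => fnl A (wC A (pT η)) v) := by
  rw [nf_eq_ΦL]
  congr 1
  ext j
  · exact kOf_translT A hA j v
  · exact fnl_wC_translT A hA _ v

/-! ## §3 The equator square and its translates -/

/-- **The constant values of the equator square** (the right-hand side of part X's `fnl_wC_sqFace`). [folklore] -/
def cB (b η : Fin 4 → Bool) : ℤ :=
  (if η 0 = false ∧ ∀ i, i ≠ (0 : Fin 4) → η i = b i then 1 else 0) - (if η 0 = true ∧ ∀ i, i ≠ (0 : Fin 4) → η i = b i then 1 else 0) +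
    (if η 0 = false ∧ ∀ i, i ≠ (0 : Fin 4) → η i = !b i then 1 else 0) -
    (if η 0 = true ∧ ∀ i, i ≠ (0 : Fin 4) → η i = !b i then 1 else 0)

omit [AddCommGroup A] [Fintype A] [DecidableEq A] in
/-- Over the normalised patterns of coordinate `0`, exactly one follows `b`. [folklore] -/
theorem sum_Pat_zero_ite (b : Fin 4 → Bool) (c : Prop) [Decidable c] :
    (∑ h ∈ Pat 0, (if (∀ i, i ≠ (0 : Fin 4) → h i = b i) ∧ c then (1 : ℤ) else 0)) = if c then 1 else 0 := by
  have hmem : Function.update b 0 false ∈ Pat 0 := by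
    rw [Pat, mem_filter, Function.update_self]; exact ⟨mem_univ _, rfl⟩
  have key : ∀ h ∈ Pat 0, ((∀ i, i ≠ (0 : Fin 4) → h i = b i) ↔ h = Function.update b 0 false) := by
    intro h hh
    have e := ind₁_eq_ite_of_mem hh b
    unfold ind₁ at e
    constructor
    · intro H
      by_contra hne
      rw [if_neg hne, if_pos (fun n hn => (H n hn).symm)] at e
      exact one_ne_zero e
    · intro H n hn; rw [H, Function.update_of_ne hn]
  rw [Finset.sum_eq_single_of_mem _ hmem]
  · simp only [(key _ hmem), true_and]
  · intro h hh hne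
    rw [if_neg]
    rintro ⟨H, -⟩
    exact hne ((key h hh).mp H)

/-- **The columns of the equator square**: `kOf j (S_b) = [j = 0]`. [folklore] -/
theorem kOf_sqFace (hA : Odd (Fintype.card A)) {P : Finset A} {u₁ u₂ : A} (h1 : u₁ ∉ P) (h2 : u₂ ∉ P) (h12 : u₁ ≠ u₂)
    (hP : P.card + 1 = Fintype.card A / 2) (b : Fin 4 → Bool) (j : Fin 4) :
    kOf A j (sqFace A P u₁ u₂ b) = if j = 0 then 1 else 0 := by
  unfold kOf
  rw [← sum_fnl_wA]
  by_cases hj : j = 0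
  · subst hj
    rw [if_pos rfl]
    simp only [fnl_wA_zero_sqFace A hA h1 h2 h12 hP, Finset.sum_add_distrib]
    rw [sum_Pat_zero_ite, sum_Pat_zero_ite]
    by_cases h0 : (0 : A) ∈ insert u₁ (insert u₂ P) <;> simp [h0]
  · rw [if_neg hj]
    exact Finset.sum_eq_zero fun h _ => fnl_wA_ne_sqFace A hA hj h 0 h1 h2 h12 b

omit [AddCommGroup A] in
/-- The constant values of the equator square are `cB b`. [folklore] -/
theorem fnl_wC_sqFace_eq_cB (hA : Odd (Fintype.card A)) {P : Finset A} {u₁ u₂ : A} (h1 : u₁ ∉ P) (h2 : u₂ ∉ P) (h12 : u₁ ≠ u₂)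
    (hP : P.card + 1 = Fintype.card A / 2) (b η : Fin 4 → Bool) : fnl A (wC A η) (sqFace A P u₁ u₂ b) = cB b η :=
  fnl_wC_sqFace A hA h1 h2 h12 hP η b

/-- The column vector of `S_b`. [folklore] -/
def kS : Fin 4 → ℤ := fun j => if j = 0 then 1 else 0
/-- The column vector of `y·S_b`. [folklore] -/
def kY (ζ : ZMod 2) : Fin 4 → ℤ := fun j => (if bY ζ j then -1 else 1) * kS (σY j)
/-- The column vector of `t·S_b`. [folklore] -/
def kT : Fin 4 → ℤ := fun j => (if bT j then -1 else 1) * kS (σT j)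
/-- The column vector of `t·y·S_b`. [folklore] -/
def kTY (ζ : ZMod 2) : Fin 4 → ℤ := fun j => (if bT j then -1 else 1) * kY ζ (σT j)

section Family
variable {P : Finset A} {u₁ u₂ : A}

/-- **`nf (S_b) = ΦL (kS, cB b)`.** [folklore] -/
theorem nf_S (hA : Odd (Fintype.card A)) (h1 : u₁ ∉ P) (h2 : u₂ ∉ P) (h12 : u₁ ≠ u₂) (hP : P.card + 1 = Fintype.card A / 2)
    (b : Fin 4 → Bool) : nf A (sqFace A P u₁ u₂ b) = ΦL A (kS, cB b) := by
  rw [nf_eq_ΦL]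
  congr 1
  ext j
  · exact kOf_sqFace A hA h1 h2 h12 hP b j
  · exact fnl_wC_sqFace_eq_cB A hA h1 h2 h12 hP b _

/-- **`nf (y·S_b) = ΦL (kY ζ, cB b ∘ pY ζ)`.** [folklore] -/
theorem nf_yS (hA : Odd (Fintype.card A)) (ζ : ZMod 2) (h1 : u₁ ∉ P) (h2 : u₂ ∉ P) (h12 : u₁ ≠ u₂)
    (hP : P.card + 1 = Fintype.card A / 2) (b : Fin 4 → Bool) :
    nf A (translY A ζ (sqFace A P u₁ u₂ b)) = ΦL A (kY ζ, fun η => cB b (pY ζ η)) := by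
  rw [nf_translY A hA]
  congr 1
  ext j
  · show (if bY ζ j then -1 else 1) * kOf A (σY j) (sqFace A P u₁ u₂ b) = (if bY ζ j then -1 else 1) * kS (σY j)
    rw [kOf_sqFace A hA h1 h2 h12 hP]; rfl
  · exact fnl_wC_sqFace_eq_cB A hA h1 h2 h12 hP b _

/-- **`nf (t·S_b) = ΦL (kT, cB b ∘ pT)`.** [folklore] -/
theorem nf_tS (hA : Odd (Fintype.card A)) (h1 : u₁ ∉ P) (h2 : u₂ ∉ P) (h12 : u₁ ≠ u₂) (hP : P.card + 1 = Fintype.card A / 2)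
    (b : Fin 4 → Bool) : nf A (translT A (sqFace A P u₁ u₂ b)) = ΦL A (kT, fun η => cB b (pT η)) := by
  rw [nf_translT A hA]
  congr 1
  ext j
  · show (if bT j then -1 else 1) * kOf A (σT j) (sqFace A P u₁ u₂ b) = (if bT j then -1 else 1) * kS (σT j)
    rw [kOf_sqFace A hA h1 h2 h12 hP]; rfl
  · exact fnl_wC_sqFace_eq_cB A hA h1 h2 h12 hP b _

/-- **`nf (t·y·S_b) = ΦL (kTY ζ, cB b ∘ pY ζ ∘ pT)`.** [folklore] -/
theorem nf_tyS (hA : Odd (Fintype.card A)) (ζ : ZMod 2) (h1 : u₁ ∉ P) (h2 : u₂ ∉ P) (h12 : u₁ ≠ u₂)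
    (hP : P.card + 1 = Fintype.card A / 2) (b : Fin 4 → Bool) :
    nf A (translT A (translY A ζ (sqFace A P u₁ u₂ b))) = ΦL A (kTY ζ, fun η => cB b (pY ζ (pT η))) := by
  rw [nf_translT A hA]
  congr 1
  ext j
  · show (if bT j then -1 else 1) * kOf A (σT j) (translY A ζ (sqFace A P u₁ u₂ b)) = (if bT j then -1 else 1) * kY ζ (σT j)
    rw [kOf_translY A hA, kOf_sqFace A hA h1 h2 h12 hP]; rfl
  · exact fnl_wC_translY A hA ζ _ _ |>.trans (fnl_wC_sqFace_eq_cB A hA h1 h2 h12 hP b _)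

end Family

end

end Summit.HodgeConjecture.CorCM.Census.QuarticInversion
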